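import Literature.Probability.Percolation.FourFunctionsProdBernoulli
import HarnessLib

/-!
# `NoHeavyLowerTail` (crux stmt-CriticalPhenomena-4575), abstract sunflower cubic: the `K`-PETAL DAYKIN CHAIN —
# `μ(E₀) μ(E₁) ⋯ μ(E_K) ≤ μ(A)^K` whenever every iterated meet of the earlier events joins every later event inside `A`

Support file (seat `prim-ineq-gen-2` gen 29; `--supports stmt-CriticalPhenomena-4575`).  No `sorry`, no new definitions.  Companion of
`…SunflowerDaykinChain` (the case of three events), memo run/shared/lean/prim/prim-ineq-gen-2/SHARP-FORM-GEN29.md §3.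

THE CHAIN [this work].  Events are listed as a head `W` and a list `L = [F₁, …, F_K]`; the CHAIN CONDITION asks, for every position `k`, that
`w ∪ S ∈ A` for all `w ∈ W ⊼ F₁ ⊼ ⋯ ⊼ F_{k−1}` (iterated family of intersections, `List.foldl (· ⊼ ·)`) and all `S ∈ F_k`.  Then
`μ(W) · Π_k μ(F_k) ≤ μ(A)^K` for `μ = prodBernoulli p` (`real_mul_prod_le_pow_of_chain`): one Ahlswede–Daykin four-events step per event,
`μ(W_k) μ(F_{k+1}) ≤ μ(W_k ⊼ F_{k+1}) μ(A)`.  For a sunflower of up-sets whose core is a principal filter `{g ⊆ ω}` the chain condition holds in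
any order (as in `DaykinChain.meetJoin_of_principalCore`: `g ∖ S ⊆ w`), so this is prim-ineq-prove-1's principal-core Π-form
(`PrincipalCore.prod_real_le_real_core_pow`) on a petal-dependent stratum; `K = 2` is `DaykinChain.lemmaA_of_meetJoin`.
-/

noncomputable section

namespace Summit.CriticalPhenomena.PercolationContinuityZ3.Theorems.SunflowerPartition

namespace DaykinChain

open MeasureTheory
open scoped SetFamily
open Literature.Probability.LatticeModels Literature.Probability.Percolation

variable {ι : Type*} [Fintype ι]

/-- **The `K`-petal Daykin chain.**  If for every decomposition `L = L₁ ++ F :: L₂` every member `w` of the iterated meet family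
`L₁.foldl (· ⊼ ·) W` and every `S ∈ F` satisfy `w ∪ S ∈ A`, then `μ(W) · Π_{F ∈ L} μ(F) ≤ μ(A)^{|L|}`. [this work] -/
theorem real_mul_prod_le_pow_of_chain (p : ι → unitInterval) (A : Set (Set ι)) :
    ∀ (L : List (Set (Set ι))) (W : Set (Set ι)),
      (∀ (L₁ : List (Set (Set ι))) (F : Set (Set ι)) (L₂ : List (Set (Set ι))), L = L₁ ++ F :: L₂ →
        ∀ w ∈ L₁.foldl (· ⊼ ·) W, ∀ S ∈ F, w ∪ S ∈ A) →
      (prodBernoulli p).real W * (L.map fun F => (prodBernoulli p).real F).prod ≤ (prodBernoulli p).real A ^ L.length := by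
  classical
  intro L
  induction L with
  | nil =>
    intro W _
    simp only [List.map_nil, List.prod_nil, mul_one, List.length_nil, pow_zero]
    exact measureReal_le_one
  | cons F L ih =>
    intro W h
    have h0 : ∀ w ∈ W, ∀ S ∈ F, w ∪ S ∈ A := h [] F L rfl
    have step := prodBernoulli_fourEvents p W F (W ⊼ F) A fun a ha b hb =>
      ⟨Set.mem_infs.2 ⟨a, ha, b, hb, rfl⟩, h0 a ha b hb⟩
    have ih' := ih (W ⊼ F) fun L₁ F' L₂ hL w hw S hS =>
      h (F :: L₁) F' L₂ (by rw [hL]; rfl) w (by simpa only [List.foldl_cons] using hw) S hS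
    have hrest : 0 ≤ (L.map fun F => (prodBernoulli p).real F).prod :=
      List.prod_nonneg fun x hx => by
        obtain ⟨G, -, rfl⟩ := List.mem_map.1 hx
        exact measureReal_nonneg
    have hA : 0 ≤ (prodBernoulli p).real A := measureReal_nonneg
    simp only [List.map_cons, List.prod_cons, List.length_cons, pow_succ]
    calc (prodBernoulli p).real W * ((prodBernoulli p).real F * (L.map fun F => (prodBernoulli p).real F).prod)
        = ((prodBernoulli p).real W * (prodBernoulli p).real F) * (L.map fun F => (prodBernoulli p).real F).prod := by ring
      _ ≤ ((prodBernoulli p).real (W ⊼ F) * (prodBernoulli p).real A) * (L.map fun F => (prodBernoulli p).real F).prod :=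
        mul_le_mul_of_nonneg_right step hrest
      _ = (prodBernoulli p).real A * ((prodBernoulli p).real (W ⊼ F) * (L.map fun F => (prodBernoulli p).real F).prod) := by
        ring
      _ ≤ (prodBernoulli p).real A * (prodBernoulli p).real A ^ L.length := mul_le_mul_of_nonneg_left ih' hA
      _ = (prodBernoulli p).real A ^ L.length * (prodBernoulli p).real A := by ring

/-- The three-event case of the chain is `lemmaA_of_meetJoin` (sanity restatement through the list form). [this work] -/
theorem lemmaA_of_meetJoin' (p : ι → unitInterval) {E₁ E₂ E₃ A : Set (Set ι)}
    (hjoin : ∀ S ∈ E₁, ∀ S' ∈ E₂, S ∪ S' ∈ A)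
    (hmj : ∀ S ∈ E₁, ∀ S' ∈ E₂, ∀ S'' ∈ E₃, (S ∩ S') ∪ S'' ∈ A) :
    (prodBernoulli p).real E₁ * ((prodBernoulli p).real E₂ * (prodBernoulli p).real E₃) ≤ (prodBernoulli p).real A ^ 2 := by
  classical
  have h := real_mul_prod_le_pow_of_chain p A [E₂, E₃] E₁ ?_
  · simpa only [List.map_cons, List.map_nil, List.prod_cons, List.prod_nil, mul_one, List.length_cons, List.length_nil] using h
  intro L₁ F L₂ hL w hw S hS
  -- `L₁` is `[]` (then `F = E₂`) or `[E₂]` (then `F = E₃`)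
  rcases L₁ with _ | ⟨X, L₁'⟩
  · simp only [List.nil_append, List.cons.injEq] at hL
    obtain ⟨rfl, -⟩ := hL
    exact hjoin w hw S hS
  · simp only [List.cons_append, List.cons.injEq] at hL
    obtain ⟨rfl, hL'⟩ := hL
    rcases L₁' with _ | ⟨Y, L₁''⟩
    · simp only [List.nil_append, List.cons.injEq] at hL'
      obtain ⟨rfl, -⟩ := hL'
      simp only [List.foldl_cons, List.foldl_nil] at hw
      obtain ⟨a, ha, b, hb, rfl⟩ := Set.mem_infs.1 hw
      exact hmj a ha b hb S hS
    · exfalso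
      simp only [List.cons_append, List.cons.injEq] at hL'
      obtain ⟨-, hL''⟩ := hL'
      have := congrArg List.length hL''
      simp at this

end DaykinChain

end Summit.CriticalPhenomena.PercolationContinuityZ3.Theorems.SunflowerPartition

end
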